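import Mathlib.RingTheory.MvPolynomial.EulerIdentity
import Literature.AlgebraicGeometry.Motives.AffineAlgebraicDeRham
import HarnessLib

/-!
# The algebraic Poincaré lemma for polynomial differential forms on affine space

Topic `Literature/AlgebraicGeometry/Motives`; a sibling of `AffineAlgebraicDeRham` (Grothendieck's
comparison theorem for smooth affine varieties over `ℂ`, named fact `AffineAlgebraicDeRham`). This
file proves, for the concrete de Rham complex `(AffineDeRham.PolyForm k n •, AffineDeRham.extDeriv)`
of polynomial forms on affine `n`-space over a commutative ring `k ⊇ ℚ` defined there, the
**Poincaré lemma** [Hartshorne1975, Ch. II, Prop. 7.1 and the Remark following it]: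

* `AffineDeRham.exists_extDeriv_eq` — every closed polynomial `(p+1)`-form on `𝔸ⁿ_k` is exact;
* `AffineDeRham.eq_C_of_extDeriv_ofPoly_eq_zero` — a polynomial with `df = 0` is constant;

i.e. `0 → k → k[x₁,…,xₙ] → Ω¹ → ⋯ → Ωⁿ → 0` is exact. These are the de Rham side of the case
`X = 𝔸ⁿ` (`I = ⊥`) of `AffineAlgebraicDeRham` (`H⁰_dR(𝔸ⁿ) = k`, `H^p_dR(𝔸ⁿ) = 0` for `p > 0`,
[Hartshorne1975, Ch. II §7, p. 53]); the cohomological consequences and the comparison with the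
singular cohomology of `ℂⁿ` are drawn in `AffineAlgebraicDeRhamAffineSpaceProofs`.

## Proof

Hartshorne's printed proof is an induction on `n` ("integrate out `x₁`"). We follow instead the
equally standard weight argument, which is shorter in the coordinate-free encoding of forms used by
`AffineAlgebraicDeRham` (forms are alternating maps on constant integer vector fields):

1. `curryLeft_alternatizeUncurryFin_add` — a Cartan formula for Mathlib's
   `AlternatingMap.alternatizeUncurryFin`: contracting the alternatized uncurrying of `f` with `x`,
   plus the alternatized uncurrying of `f` contracted with `x`, is evaluation `f x`;
2. `curryLeft_extDeriv_add` — hence Cartan's formula `ι_x dω + d ι_x ω = L_x ω` for a *constant*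
   field `x ∈ ℤⁿ`, where `L_x ω = ∂_x ∘ ω` differentiates the coefficients (`lieAlong`);
3. `extDeriv_iotaEuler_add` — multiplying by `xⱼ` and summing (Leibniz rule `extDeriv_smul` of the
   parent file and Mathlib's `alternatizeUncurryFin_curryLeft`): for the Euler field `E = Σ xⱼ ∂ⱼ`,
   `d ι_E ω + ι_E dω = (p+1) ω + E ∘ ω` on `(p+1)`-forms (the weight operator `weightOp (p+1)`,
   which multiplies `x^s dx_J` by `|s| + |J|`);
4. `weightInv` — over `k ⊇ ℚ` the weight operator `c + E`, `c ≥ 1`, is invertible on `k[x]`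
   (diagonal in the monomial basis with eigenvalues `|s| + c ≥ 1`), and `E f = 0 ⇒ f` constant;
5. the weight operators commute with `d` (from 3 and `d ∘ d = 0`), so for `dω = 0` the form
   `θ = (c + E)⁻¹ ω` is closed and `ω = (c + E) θ = d(ι_E θ)`.

Everything is proved; no named facts are introduced (D-0026).

## References

* [Hartshorne1975] R. Hartshorne, *On the de Rham cohomology of algebraic varieties*, Publ. Math.
  IHÉS 45 (1975), Ch. II §7: p. 53 (cohomology of `𝔸ⁿ`), Prop. (7.1) (Poincaré lemma) and the
  Remark after it (any ring containing `ℚ`).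
* [Grothendieck1966] A. Grothendieck, *On the de Rham cohomology of algebraic varieties*,
  Publ. Math. IHÉS 29 (1966) 95–103, Thm 1.
-/

noncomputable section

open MvPolynomial

namespace Literature.AlgebraicGeometry.Motives

namespace AffineDeRham

/-! ### A Cartan formula for `alternatizeUncurryFin` -/

section Cartan

/-- Removing the `(i+1)`-st entry of the tuple `(x, v₀, …, v_q)` gives `(x, v₀, …, v̂ᵢ, …, v_q)`.
[folklore] -/
theorem removeNth_succ_cons {α : Type*} {q : ℕ} (x : α) (v : Fin (q + 1) → α) (i : Fin (q + 1)) :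
    i.succ.removeNth (Fin.cons x v : Fin (q + 2) → α) = Fin.cons x (i.removeNth v) := by
  funext j
  cases j using Fin.cases with
  | zero => simp [Fin.removeNth_apply]
  | succ j => simp [Fin.removeNth_apply]

variable {R M N : Type*} [CommRing R] [AddCommGroup M] [Module R M] [AddCommGroup N] [Module R N]
  {q : ℕ}

/-- **Cartan's formula for `alternatizeUncurryFin`.** For `f : M →ₗ (M [⋀^Fin (q+1)]→ₗ N)` and
`x ∈ M`: contracting the alternatized uncurrying `A f` (Mathlib's
`AlternatingMap.alternatizeUncurryFin`, `(A f)(v₀,…,v_{q+1}) = Σᵢ (−1)ⁱ f(vᵢ)(…v̂ᵢ…)`) with `x` in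
the first slot, plus the alternatized uncurrying of `v ↦ ι_x f(v)`, gives back `f x`:
`ι_x (A f) + A (ι_x ∘ f) = f x`. (In the expansion of `(A f)(x, v₀, …, v_q)` the term `i = 0` is
`f(x)(v)`, and the remaining terms cancel against `A (ι_x ∘ f)(v)`.) This is the algebraic identity
behind `ι_X d + d ι_X = L_X` for constant vector fields. [folklore] -/
theorem curryLeft_alternatizeUncurryFin_add (f : M →ₗ[R] M [⋀^Fin (q + 1)]→ₗ[R] N) (x : M) :
    (AlternatingMap.alternatizeUncurryFin f).curryLeft x +
      AlternatingMap.alternatizeUncurryFin (AlternatingMap.curryLeftLinearMap.flip x ∘ₗ f) =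
        f x := by
  refine AlternatingMap.ext fun v => ?_
  simp only [AlternatingMap.add_apply, AlternatingMap.curryLeft_apply_apply,
    AlternatingMap.alternatizeUncurryFin_apply, LinearMap.coe_comp, Function.comp_apply,
    LinearMap.flip_apply, AlternatingMap.curryLeftLinearMap_apply, Matrix.vecCons]
  rw [Fin.sum_univ_succ, add_assoc, ← Finset.sum_add_distrib, Finset.sum_eq_zero, add_zero]
  · simp
  · intro i _
    rw [Fin.val_succ, pow_succ, Fin.cons_succ, removeNth_succ_cons, mul_neg_one, neg_smul,
      neg_add_cancel]

end Cartan

variable {k : Type*} [CommRing k] {n p : ℕ}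

/-! ### Cartan's formula for constant vector fields -/

/-- Differentiating the coefficients of a contraction `ι_x ω` is contracting the differentiated
coefficients: `L_v (ι_x ω) = ι_x (L_v ω)` for constant fields `v, x`. [folklore] -/
theorem lieAlong_curryLeft (ω : PolyForm k n (p + 1)) (x : Fin n → ℤ) :
    lieAlong (ω.curryLeft x) = AlternatingMap.curryLeftLinearMap.flip x ∘ₗ lieAlong ω :=
  LinearMap.ext fun _ => AlternatingMap.ext fun _ => rfl

/-- **Cartan's formula for a constant vector field** `x ∈ ℤⁿ` on polynomial forms:
`ι_x (dω) + d(ι_x ω) = L_x ω`, where `(L_x ω)(u) = ∂_x (ω(u))` (`lieAlong ω x`; all brackets of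
constant fields vanish) and `ι_x` is contraction in the first slot (`AlternatingMap.curryLeft`).
[folklore] -/
theorem curryLeft_extDeriv_add (ω : PolyForm k n (p + 1)) (x : Fin n → ℤ) :
    (extDeriv ω).curryLeft x + extDeriv (ω.curryLeft x) = lieAlong ω x := by
  simp only [extDeriv, lieAlong_curryLeft]
  exact curryLeft_alternatizeUncurryFin_add (lieAlong ω) x

/-! ### The Euler operator and the weight operators on polynomials -/

variable (k n) in
/-- The **Euler operator** `E = Σᵢ xᵢ ∂/∂xᵢ` on `P = k[x₁, …, xₙ]`, as a `k`-linear map (the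
derivative along the Euler vector field; `E(x^s) = |s| x^s`). [folklore] -/
def eulerOp : MvPolynomial (Fin n) k →ₗ[k] MvPolynomial (Fin n) k :=
  ∑ i : Fin n, LinearMap.mulLeft k (X i) ∘ₗ
    ((pderiv i : Derivation k (MvPolynomial (Fin n) k) (MvPolynomial (Fin n) k)) :
      MvPolynomial (Fin n) k →ₗ[k] MvPolynomial (Fin n) k)

/-- `E f = Σᵢ xᵢ ∂f/∂xᵢ`. [folklore] -/
theorem eulerOp_apply (f : MvPolynomial (Fin n) k) :
    eulerOp k n f = ∑ i : Fin n, X i * pderiv i f := by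
  simp [eulerOp, LinearMap.sum_apply]

/-- Euler's identity on monomials: `E(a x^s) = |s| · a x^s`. [folklore] -/
theorem eulerOp_monomial (s : Fin n →₀ ℕ) (a : k) :
    eulerOp k n (monomial s a) = (∑ i, s i) • monomial s a := by
  rw [eulerOp_apply, Finset.sum_smul]
  exact Finset.sum_congr rfl fun i _ => X_mul_pderiv_monomial

/-- The **weight operator** `c + E` on `k[x₁, …, xₙ]` (`c : ℕ`): it multiplies `x^s` by `|s| + c`.
On the coefficients of a `c`-form it is the total weight `L_E` (polynomial degree plus form degree).
[folklore] -/
def weightOp (c : ℕ) : MvPolynomial (Fin n) k →ₗ[k] MvPolynomial (Fin n) k :=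
  c • LinearMap.id + eulerOp k n

/-- `(c + E) f = c f + E f`. [folklore] -/
@[simp]
theorem weightOp_apply (c : ℕ) (f : MvPolynomial (Fin n) k) :
    weightOp c f = c • f + eulerOp k n f := by
  simp [weightOp]

/-- `(c + E)(x^s) = (|s| + c) x^s`. [folklore] -/
theorem weightOp_monomial (c : ℕ) (s : Fin n →₀ ℕ) (a : k) :
    weightOp (k := k) c (monomial s a) = (∑ i, s i + c) • monomial s a := by
  rw [weightOp_apply, eulerOp_monomial, add_smul, add_comm]

section RatAlgebra

variable [Algebra ℚ k]

/-- The inverse weight operator over a `ℚ`-algebra `k`: the `k`-linear map with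
`x^s ↦ (|s| + c)⁻¹ x^s` (and `1 ↦ 0` when `c = 0`, by the convention `0⁻¹ = 0`), defined on the
monomial basis (`MvPolynomial.basisMonomials`). [folklore] -/
def weightInv (c : ℕ) : MvPolynomial (Fin n) k →ₗ[k] MvPolynomial (Fin n) k :=
  (basisMonomials (Fin n) k).constr k fun s =>
    monomial s (algebraMap ℚ k ((∑ i, s i : ℕ) + c : ℚ)⁻¹)

/-- `weightInv c (x^s) = (|s| + c)⁻¹ x^s`. [folklore] -/
theorem weightInv_monomial_one (c : ℕ) (s : Fin n →₀ ℕ) :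
    weightInv (k := k) c (monomial s 1) =
      monomial s (algebraMap ℚ k ((∑ i, s i : ℕ) + c : ℚ)⁻¹) := by
  have h := (basisMonomials (Fin n) k).constr_basis k
    (fun s => monomial s (algebraMap ℚ k ((∑ i, s i : ℕ) + c : ℚ)⁻¹)) s
  rwa [coe_basisMonomials] at h

/-- The scalar identity behind the inversion: `m · (m⁻¹) = 1` in `k` for `m ≠ 0`. [folklore] -/
theorem nsmul_algebraMap_inv {m : ℕ} (hm : m ≠ 0) :
    m • algebraMap ℚ k (m : ℚ)⁻¹ = 1 := by
  rw [← Nat.cast_smul_eq_nsmul ℚ, Algebra.smul_def, ← map_mul,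
    mul_inv_cancel₀ (Nat.cast_ne_zero.mpr hm), map_one]

/-- `(c + E) ∘ (c + E)⁻¹ = id` on `k[x]` for `c ≥ 1`. [folklore] -/
theorem weightOp_comp_weightInv {c : ℕ} (hc : c ≠ 0) :
    weightOp c ∘ₗ weightInv (k := k) (n := n) c = LinearMap.id := by
  refine (basisMonomials (Fin n) k).ext fun s => ?_
  simp only [coe_basisMonomials, LinearMap.comp_apply, LinearMap.id_apply]
  rw [weightInv_monomial_one, weightOp_monomial, ← map_nsmul, ← Nat.cast_add,
    nsmul_algebraMap_inv (by omega)]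

/-- `(c + E)⁻¹ ∘ (c + E) = id` on `k[x]` for `c ≥ 1`. [folklore] -/
theorem weightInv_comp_weightOp {c : ℕ} (hc : c ≠ 0) :
    weightInv (k := k) (n := n) c ∘ₗ weightOp c = LinearMap.id := by
  refine (basisMonomials (Fin n) k).ext fun s => ?_
  simp only [coe_basisMonomials, LinearMap.comp_apply, LinearMap.id_apply]
  rw [weightOp_monomial, map_nsmul, weightInv_monomial_one, ← map_nsmul, ← Nat.cast_add,
    nsmul_algebraMap_inv (by omega)]

/-- `E⁻¹ ∘ E = id − (constant term)`: `weightInv 0 (E f) = f − f(0)`. [folklore] -/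
theorem weightInv_zero_comp_eulerOp :
    weightInv (k := k) (n := n) 0 ∘ₗ eulerOp k n =
      LinearMap.id - Algebra.linearMap k (MvPolynomial (Fin n) k) ∘ₗ lcoeff k 0 := by
  refine (basisMonomials (Fin n) k).ext fun s => ?_
  simp only [coe_basisMonomials, LinearMap.comp_apply, LinearMap.sub_apply, LinearMap.id_apply,
    lcoeff_apply, Algebra.linearMap_apply, algebraMap_eq, coeff_monomial]
  rw [eulerOp_monomial, map_nsmul, weightInv_monomial_one, ← map_nsmul]
  by_cases hs : s = 0
  · subst hs
    simp
  · have hsum : (∑ i, s i) ≠ 0 := by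
      intro h0
      apply hs
      ext i
      exact (Finset.sum_eq_zero_iff.mp h0) i (Finset.mem_univ i)
    rw [Nat.cast_zero, add_zero, nsmul_algebraMap_inv hsum, if_neg hs, C_0, sub_zero]

/-- **A polynomial killed by the Euler operator is constant** (over `k ⊇ ℚ`): `E f = 0 ⇒ f = f(0)`.
[folklore] -/
theorem eq_C_of_eulerOp_eq_zero {f : MvPolynomial (Fin n) k} (hf : eulerOp k n f = 0) :
    f = C (coeff 0 f) := by
  have h := congrArg (fun φ : MvPolynomial (Fin n) k →ₗ[k] MvPolynomial (Fin n) k => φ f)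
    (weightInv_zero_comp_eulerOp (k := k) (n := n))
  simp only [LinearMap.comp_apply, hf, map_zero, LinearMap.sub_apply, LinearMap.id_apply,
    lcoeff_apply, Algebra.linearMap_apply, algebraMap_eq] at h
  exact (sub_eq_zero.mp h.symm)

end RatAlgebra

/-! ### Coefficientwise operators on forms; the Euler contraction -/

/-- Apply a `k`-linear endomorphism of `P = k[x₁, …, xₙ]` to the coefficients of a form:
`(coeffMap φ ω)(v) = φ(ω(v))`. [folklore] -/
def coeffMap (φ : MvPolynomial (Fin n) k →ₗ[k] MvPolynomial (Fin n) k) (ω : PolyForm k n p) :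
    PolyForm k n p :=
  (φ.restrictScalars ℤ).compAlternatingMap ω

/-- `(coeffMap φ ω)(v) = φ(ω(v))`. [folklore] -/
@[simp]
theorem coeffMap_apply (φ : MvPolynomial (Fin n) k →ₗ[k] MvPolynomial (Fin n) k)
    (ω : PolyForm k n p) (v : Fin p → Fin n → ℤ) : coeffMap φ ω v = φ (ω v) :=
  rfl

/-- `coeffMap` is compatible with composition. [folklore] -/
theorem coeffMap_comp (φ ψ : MvPolynomial (Fin n) k →ₗ[k] MvPolynomial (Fin n) k)
    (ω : PolyForm k n p) : coeffMap (φ ∘ₗ ψ) ω = coeffMap φ (coeffMap ψ ω) :=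
  rfl

/-- `coeffMap id = id`. [folklore] -/
@[simp]
theorem coeffMap_id (ω : PolyForm k n p) : coeffMap LinearMap.id ω = ω :=
  AlternatingMap.ext fun _ => rfl

/-- `coeffMap φ 0 = 0`. [folklore] -/
@[simp]
theorem coeffMap_zero (φ : MvPolynomial (Fin n) k →ₗ[k] MvPolynomial (Fin n) k) :
    coeffMap φ (0 : PolyForm k n p) = 0 :=
  AlternatingMap.ext fun _ => by simp

/-- The weight operator on forms: `coeffMap (c + E) ω = c ω + E ∘ ω`. [folklore] -/
theorem coeffMap_weightOp (c : ℕ) (ω : PolyForm k n p) :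
    coeffMap (weightOp c) ω = c • ω + coeffMap (eulerOp k n) ω :=
  AlternatingMap.ext fun v => by simp

/-- The **Euler contraction** `ι_E ω = Σⱼ xⱼ ι_{eⱼ} ω` of a `(p+1)`-form with the Euler vector field
`E = Σⱼ xⱼ eⱼ`: `(ι_E ω)(u₁, …, u_p) = Σⱼ xⱼ ω(eⱼ, u₁, …, u_p)`. [folklore] -/
def iotaEuler (ω : PolyForm k n (p + 1)) : PolyForm k n p :=
  ∑ j : Fin n, (X j : MvPolynomial (Fin n) k) • ω.curryLeft (Pi.single j 1)

/-- `ι_E 0 = 0`. [folklore] -/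
@[simp]
theorem iotaEuler_zero : iotaEuler (0 : PolyForm k n (p + 1)) = 0 := by
  simp [iotaEuler]

/-- The scalar `C m`, `m ∈ ℤ`, acts on forms as the integer `m`. [folklore] -/
theorem C_intCast_smul (m : ℤ) (η : PolyForm k n p) :
    (C (m : k) : MvPolynomial (Fin n) k) • η = m • η := by
  refine AlternatingMap.ext fun u => ?_
  rw [AlternatingMap.smul_apply, AlternatingMap.smul_apply, smul_eq_mul, zsmul_eq_mul,
    ← map_intCast (C : k →+* MvPolynomial (Fin n) k) m]

/-- `Σⱼ dxⱼ ⊗ ι_{eⱼ} ω = ι_• ω`: the sum over `j` of the gradient of `xⱼ` tensor the contraction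
with `eⱼ` is the contraction map `v ↦ ι_v ω` itself (`v = Σⱼ vⱼ eⱼ`). [folklore] -/
theorem sum_grad_X_smulRight_curryLeft (ω : PolyForm k n (p + 1)) :
    ∑ j : Fin n, (grad (X j : MvPolynomial (Fin n) k)).smulRight (ω.curryLeft (Pi.single j 1)) =
      ω.curryLeft := by
  refine LinearMap.ext fun v => ?_
  rw [LinearMap.sum_apply]
  simp only [LinearMap.smulRight_apply, grad_apply, dirDeriv_X, C_intCast_smul, ← map_zsmul,
    ← map_sum]
  congr 1
  conv_rhs => rw [← Finset.univ_sum_single v]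
  exact Finset.sum_congr rfl fun j _ => by
    rw [← Pi.single_smul, smul_eq_mul, mul_one]

/-- `Σⱼ dxⱼ ∧ ι_{eⱼ} ω = (p+1) ω` for a `(p+1)`-form `ω` (Mathlib's
`alternatizeUncurryFin_curryLeft`). [folklore] -/
theorem sum_dWedge_X_curryLeft (ω : PolyForm k n (p + 1)) :
    ∑ j : Fin n, dWedge (X j) (ω.curryLeft (Pi.single j 1)) = (p + 1) • ω := by
  have h : ∑ j : Fin n, dWedge (X j) (ω.curryLeft (Pi.single j 1)) =
      AlternatingMap.alternatizeUncurryFinLM (R := ℤ)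
        (∑ j : Fin n, (grad (X j : MvPolynomial (Fin n) k)).smulRight
          (ω.curryLeft (Pi.single j 1))) := by
    rw [map_sum]
    rfl
  rw [h, sum_grad_X_smulRight_curryLeft, AlternatingMap.alternatizeUncurryFinLM_apply,
    AlternatingMap.alternatizeUncurryFin_curryLeft]

/-- Evaluation of a finite sum of forms. [folklore] -/
theorem PolyForm.sum_apply {ι : Type*} (s : Finset ι) (ω : ι → PolyForm k n p)
    (u : Fin p → Fin n → ℤ) : (∑ j ∈ s, ω j) u = ∑ j ∈ s, ω j u := by
  induction s using Finset.cons_induction with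
  | empty => simp
  | cons j s hj ih => simp [Finset.sum_cons, ih]

/-- `Σⱼ xⱼ L_{eⱼ} ω = E ∘ ω`: summing the coordinate Lie derivatives with polynomial weights `xⱼ`
gives the Euler operator on the coefficients. [folklore] -/
theorem sum_X_smul_lieAlong_single (ω : PolyForm k n p) :
    ∑ j : Fin n, (X j : MvPolynomial (Fin n) k) • lieAlong ω (Pi.single j 1) =
      coeffMap (eulerOp k n) ω := by
  refine AlternatingMap.ext fun u => ?_
  rw [PolyForm.sum_apply, coeffMap_apply, eulerOp_apply]
  exact Finset.sum_congr rfl fun j _ => by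
    rw [AlternatingMap.smul_apply, lieAlong_apply, dirDeriv_single, smul_eq_mul]

/-- `d` of a finite sum of forms. [folklore] -/
theorem extDeriv_sum {ι : Type*} (s : Finset ι) (ω : ι → PolyForm k n p) :
    extDeriv (∑ j ∈ s, ω j) = ∑ j ∈ s, extDeriv (ω j) := by
  have h := map_sum (extDerivₗ k n p) ω s
  simp only [extDerivₗ_apply] at h
  exact h

/-- **Cartan's formula for the Euler vector field** on polynomial `(p+1)`-forms:
`d(ι_E ω) + ι_E(dω) = (p + 1) ω + E ∘ ω = L_E ω`, the weight operator (on `x^s dx_J` it is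
multiplication by `|s| + |J|`). [folklore] -/
theorem extDeriv_iotaEuler_add (ω : PolyForm k n (p + 1)) :
    extDeriv (iotaEuler ω) + iotaEuler (extDeriv ω) = coeffMap (weightOp (p + 1)) ω := by
  have h1 : extDeriv (iotaEuler ω) = ∑ j : Fin n, (dWedge (X j) (ω.curryLeft (Pi.single j 1)) +
      (X j : MvPolynomial (Fin n) k) • extDeriv (ω.curryLeft (Pi.single j 1))) := by
    rw [iotaEuler, extDeriv_sum]
    exact Finset.sum_congr rfl fun j _ => extDeriv_smul _ _
  have h2 : iotaEuler (extDeriv ω) =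
      ∑ j : Fin n, (X j : MvPolynomial (Fin n) k) • (extDeriv ω).curryLeft (Pi.single j 1) := rfl
  rw [h1, h2, Finset.sum_add_distrib, add_assoc, ← Finset.sum_add_distrib, sum_dWedge_X_curryLeft,
    coeffMap_weightOp, ← sum_X_smul_lieAlong_single]
  congr 1
  exact Finset.sum_congr rfl fun j _ => by
    rw [← smul_add, add_comm (extDeriv _) _, curryLeft_extDeriv_add]

/-- The weight operators commute with `d`: `d ∘ (p+1+E) = (p+2+E) ∘ d` on `(p+1)`-forms (both sides
equal `d ι_E d`, by Cartan's formula and `d ∘ d = 0`). [folklore] -/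
theorem extDeriv_coeffMap_weightOp (ω : PolyForm k n (p + 1)) :
    extDeriv (coeffMap (weightOp (p + 1)) ω) = coeffMap (weightOp (p + 1 + 1)) (extDeriv ω) := by
  rw [← extDeriv_iotaEuler_add, ← extDeriv_iotaEuler_add, extDeriv_add, extDeriv_extDeriv,
    extDeriv_extDeriv, zero_add, iotaEuler_zero, add_zero]

section RatAlgebra

variable [Algebra ℚ k]

/-- `(c + E) (c + E)⁻¹ ω = ω` on forms, `c ≥ 1`. [folklore] -/
theorem coeffMap_weightOp_weightInv {c : ℕ} (hc : c ≠ 0) (ω : PolyForm k n p) :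
    coeffMap (weightOp c) (coeffMap (weightInv c) ω) = ω := by
  rw [← coeffMap_comp, weightOp_comp_weightInv hc, coeffMap_id]

/-- `(c + E)⁻¹ (c + E) ω = ω` on forms, `c ≥ 1`. [folklore] -/
theorem coeffMap_weightInv_weightOp {c : ℕ} (hc : c ≠ 0) (ω : PolyForm k n p) :
    coeffMap (weightInv c) (coeffMap (weightOp c) ω) = ω := by
  rw [← coeffMap_comp, weightInv_comp_weightOp hc, coeffMap_id]

/-- **Poincaré lemma for polynomial forms, positive degree** [Hartshorne1975, Ch. II Prop. 7.1
with the Remark following it]: over a commutative ring `k ⊇ ℚ`, every closed polynomial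
`(p+1)`-form `ω` on affine `n`-space is exact, with the explicit primitive
`η = ι_E ((p+1+E)⁻¹ ω)`. [cite: Hartshorne1975, Ch. II Prop. 7.1] -/
theorem exists_extDeriv_eq (ω : PolyForm k n (p + 1)) (hω : extDeriv ω = 0) :
    ∃ η : PolyForm k n p, extDeriv η = ω := by
  set θ : PolyForm k n (p + 1) := coeffMap (weightInv (p + 1)) ω with hθdef
  have hθ : coeffMap (weightOp (p + 1)) θ = ω := coeffMap_weightOp_weightInv (by omega) ω
  have hdθ : extDeriv θ = 0 := by
    have h1 : coeffMap (weightOp (p + 1 + 1)) (extDeriv θ) = 0 := by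
      rw [← extDeriv_coeffMap_weightOp, hθ, hω]
    have h2 := congrArg (coeffMap (weightInv (k := k) (n := n) (p + 1 + 1))) h1
    rwa [coeffMap_weightInv_weightOp (by omega), coeffMap_zero] at h2
  refine ⟨iotaEuler θ, ?_⟩
  have h := extDeriv_iotaEuler_add θ
  rwa [hdθ, iotaEuler_zero, add_zero, hθ] at h

/-- **Poincaré lemma for polynomial forms, degree zero** [Hartshorne1975, Ch. II Prop. 7.1]:
over `k ⊇ ℚ`, a polynomial `f` with `df = 0` is constant, `f = f(0)`.
[cite: Hartshorne1975, Ch. II Prop. 7.1] -/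
theorem eq_C_of_extDeriv_ofPoly_eq_zero (f : MvPolynomial (Fin n) k) (h : extDeriv (ofPoly f) = 0) :
    f = C (coeff 0 f) := by
  classical
  have hp : ∀ i : Fin n, pderiv i f = 0 := fun i => by
    have hi := congrArg (fun ω : PolyForm k n 1 => ω fun _ => Pi.single i 1) h
    simpa [extDeriv_ofPoly_apply, dirDeriv_single] using hi
  refine eq_C_of_eulerOp_eq_zero ?_
  rw [eulerOp_apply]
  exact Finset.sum_eq_zero fun i _ => by rw [hp i, mul_zero]

end RatAlgebra

/-- Conversely constants are closed: `d(c) = 0`. [folklore] -/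
@[simp]
theorem extDeriv_ofPoly_C (c : k) : extDeriv (ofPoly (C c : MvPolynomial (Fin n) k)) = 0 :=
  AlternatingMap.ext fun v => by simp [extDeriv_ofPoly_apply]

end AffineDeRham

end Literature.AlgebraicGeometry.Motives

end
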